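import Literature.NumberTheory.Automorphic.UnitaryGroupLineUnipotentTwo
import Literature.NumberTheory.Automorphic.UnitaryGroupRationalBorelCoveringWeights
import HarnessLib

/-!
# The Haar mass of a strict fundamental set of `N(F)` in the line `N(𝔸_F) ≤ B(𝔸_F)` of `U(J₂)` is positive and finite
(Rogawski, *Automorphic Representations of Unitary Groups in Three Variables* (1990), §2.1 (p. 11) and §7.3 (pp. 96–98):
`N(F)∖N(𝔸_F)` is compact — «`m(N∖𝐍) = 1`» is a legitimate normalisation, for `G = U(3)`, `U(2)`, `U(2) × U(1)` alike;
Arthur, *A trace formula for reductive groups I*, Duke Math. J. 45 (1978), §1; Cassels–Fröhlich (1967), Ch. II §14 for the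
compactness of `F∖𝔸_F`.)

Topic `NumberTheory/Automorphic`; namespace `Literature.NumberTheory.Automorphic.UnitaryGroup`. THEOREMS ONLY over
accepted tree modules (no definition, no named fact, no instance, no notation, no `sorry`). H-side copy at `N = 2` (cell
`pub/hodgecm-mathlib`, crux H413, census `CENSUS-LAWS-Hside` §3 (σ-u), row (S)_two) of ★ (S)
`UnitaryGroupUnipotentStrictFundamentalSetMass` (typed at `N = 3` over the Heisenberg box): the factor `μ_N(Ω)` that ★
(C-G)_two `exists_weight_torus_kAverage_of_unipotent_invariant_two` (`UnitaryGroupUnipotentInvariantUnfoldingTwo`) keeps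
VISIBLE — for a measurable STRICT fundamental set `Ω ⊆ unipotentInBorel F E c 2` of `N(F)_N` (every orbit meets `Ω`
exactly once; such an `Ω` exists, ★ `exists_measurableSet_existsUnique_smul_mem_unipotentInBorel`, every `N`) and ANY Haar
measure `μ_N` of `N(𝔸_F) ≤ B(𝔸_F)` — is POSITIVE and FINITE, so it cancels from the (σ-u) head of `U(J₂)` (Rogawski
Prop. 7.3.1) exactly as «`m(N∖𝐍) = 1`» does in print.

PROOF (definition-free). Transport `μ_N` along the tautological topological isomorphism `N(𝔸_F) = adelicUnipotent F E c 2
≃ₜ* unipotentInBorel F E c 2` (the same adelic points viewed inside `B(𝔸_F)`; built INSIDE the proof, no `def`) to a Haar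
measure `ν` of `adelicUnipotent F E c 2`; there the preimage of `Ω` is an a.e. fundamental domain of `N(F) = rationalUnipotent`
(strictness transports), so its `ν`-mass equals that of the LINE BOX `n(𝓕⁻)` (★ H-B1
`isFundamentalDomain_image_traceZeroFundamentalDomain_two`, Mathlib `IsFundamentalDomain.measure_eq`), which is finite (★
`measure_image_traceZeroFundamentalDomain_lt_top_two`) — and non-zero because a fundamental domain of a countable group in a
space with a non-zero invariant measure has positive mass (Mathlib `IsFundamentalDomain.measure_ne_zero`).

* `measure_strictFundamentalSet_unipotent_ne_zero_and_lt_top_two` — **`μ_N(Ω) ≠ 0 ∧ μ_N(Ω) < ∞`**;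
  `measure_strictFundamentalSet_unipotent_ne_zero_two`, `measure_strictFundamentalSet_unipotent_ne_top_two`,
  `measureReal_strictFundamentalSet_unipotent_pos_two` (`0 < μ_N.real Ω`, the invertible factor of ★ (C-G)_two (B));
* `exists_strictFundamentalSet_unipotent_two` — a measurable strict fundamental set `Ω` of `N(F)_N` in `N(𝔸_F) ≤ B(𝔸_F)`
  of `U(J₂)` EXISTS with `0 < μ_N(Ω) < ∞` for every Haar `μ_N` (the `(hΩ, hΩu)` data of ★ (C-G)_two, packaged).

HC_CM is proved only modulo the 7 printed citations until rung 0 closes — nothing here bears on a summit statement.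

## References
* J. D. Rogawski, *Automorphic Representations of Unitary Groups in Three Variables*, Ann. of Math. Stud. 123 (1990),
  §2.1 (p. 11), §7.3 (pp. 96–98) [Rogawski1990].
* J. Arthur, *A trace formula for reductive groups I*, Duke Math. J. 45 (1978), §1 [Arthur1978TraceFormulaI].
* J. W. S. Cassels, A. Fröhlich (eds.), *Algebraic Number Theory* (1967), Ch. II §14 [CasselsFrohlichANT1967].
-/

set_option autoImplicit false

noncomputable section

open MeasureTheory MeasureTheory.Measure Set NumberField IsDedekindDomain
open scoped ENNReal NNReal Pointwise

namespace Literature.NumberTheory.Automorphic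

namespace UnitaryGroup

variable {F E : Type} [Field F] [NumberField F] [Field E] [NumberField E] [Algebra F E]
  {c : E ≃ₐ[F] E}

variable [MeasurableSpace (quasiSplit F E c 2).Adelic] [BorelSpace (quasiSplit F E c 2).Adelic]

/-! ## §1 `0 < μ_N(Ω) < ∞` for a strict fundamental set of `N(F)_N` in the line `N(𝔸_F) ≤ B(𝔸_F)` of `U(J₂)` -/

/-- **THE HAAR MASS OF A STRICT FUNDAMENTAL SET OF `N(F)_N` IN `N(𝔸_F) ≤ B(𝔸_F)` OF `U(J₂)` IS POSITIVE AND FINITE.**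
For the quasi-split `U(J₂)` (`c² = 1`), any Haar measure `μ_N` of `N(𝔸_F) = unipotentInBorel F E c 2` and any measurable
`Ω ⊆ N(𝔸_F)` meeting every `N(F)_N`-orbit exactly once: `μ_N(Ω) ≠ 0` and `μ_N(Ω) < ∞` — `N(F)∖N(𝔸_F) ≅ E⁻∖𝔸_E⁻` is
compact of positive covolume («`m(N∖𝐍) = 1`»). [cite: Rogawski1990, §2.1 (p. 11)] [cite: Rogawski1990, §7.3 (pp. 96–98)]
[cite: Arthur1978TraceFormulaI, §1] -/
theorem measure_strictFundamentalSet_unipotent_ne_zero_and_lt_top_two (hc : c * c = 1)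
    (μN : Measure (unipotentInBorel F E c 2)) [μN.IsHaarMeasure]
    {Ω : Set (unipotentInBorel F E c 2)} (hΩ : MeasurableSet Ω)
    (hΩu : ∀ n : unipotentInBorel F E c 2,
      ∃! ν : (((quasiSplit F E c 2).arithmeticSubgroup).subgroupOf (borelAdelic F E c 2)).subgroupOf
        (unipotentInBorel F E c 2), ν • n ∈ Ω) :
    μN Ω ≠ 0 ∧ μN Ω < ⊤ := by
  -- structure
  haveI : LocallyCompactSpace (AdeleRing (𝓞 E) E) := locallyCompactSpace_adeleRing' E
  letI : MeasurableSpace (AdeleRing (𝓞 E) E) := borel _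
  haveI : BorelSpace (AdeleRing (𝓞 E) E) := ⟨rfl⟩
  haveI : BorelSpace (borelAdelic F E c 2) := Subtype.borelSpace _
  haveI : BorelSpace (unipotentInBorel F E c 2) := Subtype.borelSpace _
  letI : MeasurableSpace (adelicUnipotent F E c 2) := borel _
  haveI : BorelSpace (adelicUnipotent F E c 2) := ⟨rfl⟩
  haveI : LocallyCompactSpace (adelicUnipotent F E c 2) := locallyCompactSpace_adelicUnipotent_two
  -- the tautological isomorphism `adelicUnipotent ≃ₜ* unipotentInBorel` (no `def`: a local term)
  let e₀ : adelicUnipotent F E c 2 ≃* unipotentInBorel F E c 2 :=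
    { toFun := fun u => ⟨⟨(u : (quasiSplit F E c 2).Adelic), adelicUnipotent_le_borelAdelic u.2⟩, u.2⟩
      invFun := fun v => ⟨((v : borelAdelic F E c 2) : (quasiSplit F E c 2).Adelic), v.2⟩
      left_inv := fun _ => rfl
      right_inv := fun _ => rfl
      map_mul' := fun _ _ => rfl }
  have he₀c : Continuous e₀ := (continuous_subtype_val.subtype_mk _).subtype_mk _
  have he₀s : Continuous e₀.symm := (continuous_subtype_val.comp continuous_subtype_val).subtype_mk _
  let e : adelicUnipotent F E c 2 ≃ₜ* unipotentInBorel F E c 2 :=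
    { e₀ with continuous_toFun := he₀c, continuous_invFun := he₀s }
  have hec : Continuous e := he₀c
  have hes : Continuous e.symm := he₀s
  -- transport `μ_N` to a Haar measure `ν` of `adelicUnipotent`
  set ν : Measure (adelicUnipotent F E c 2) := μN.map e.symm with hν
  haveI : ν.IsHaarMeasure := e.symm.isHaarMeasure_map μN
  have hpre : (e.symm : unipotentInBorel F E c 2 → adelicUnipotent F E c 2) ⁻¹' ((e : adelicUnipotent F E c 2 →
      unipotentInBorel F E c 2) ⁻¹' Ω) = Ω := by
    ext n
    simp only [Set.mem_preimage]
    exact Iff.of_eq (congrArg (· ∈ Ω) (e.apply_symm_apply n))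
  have hΩ' : MeasurableSet ((e : adelicUnipotent F E c 2 → unipotentInBorel F E c 2) ⁻¹' Ω) :=
    hΩ.preimage hec.measurable
  have hνΩ : ν ((e : adelicUnipotent F E c 2 → unipotentInBorel F E c 2) ⁻¹' Ω) = μN Ω := by
    rw [hν, Measure.map_apply hes.measurable hΩ', hpre]
  -- the action of `N(F) = rationalUnipotent` on `N(𝔸_F)`: measurable, measure-preserving, countable
  haveI : MeasurableConstSMul (rationalUnipotent F E c 2) (adelicUnipotent F E c 2) :=
    ⟨fun γ => (continuous_const.mul continuous_id).measurable⟩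
  haveI : SMulInvariantMeasure (rationalUnipotent F E c 2) (adelicUnipotent F E c 2) ν :=
    ⟨fun γ s _hs => by
      rw [show (fun u : adelicUnipotent F E c 2 => γ • u) ⁻¹' s =
          (fun u : adelicUnipotent F E c 2 => ((γ : adelicUnipotent F E c 2)) * u) ⁻¹' s from rfl,
        measure_preimage_mul]⟩
  haveI : Countable (rationalUnipotent F E c 2) := by
    haveI : Countable (quasiSplit F E c 2).arithmeticSubgroup := by
      haveI : Countable E := NumberField.countable' (K := E)
      haveI : Countable (Matrix (Fin 2) (Fin 2) E) := inferInstanceAs (Countable (Fin 2 → Fin 2 → E))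
      haveI : Countable (GL (Fin 2) E) := Units.val_injective.countable
      haveI : Countable (quasiSplit F E c 2).Rational :=
        inferInstanceAs (Countable (rational F E c 2 ((StdForm.antidiagonal 2).over E)))
      exact (Set.countable_range _).to_subtype
    have h1 : Function.Injective fun γ : rationalUnipotent F E c 2 =>
        (⟨((γ : adelicUnipotent F E c 2) : (quasiSplit F E c 2).Adelic), γ.2⟩ :
          (quasiSplit F E c 2).arithmeticSubgroup) := fun a a' h =>
      Subtype.ext (Subtype.ext (congrArg
        (fun z : (quasiSplit F E c 2).arithmeticSubgroup => (z : (quasiSplit F E c 2).Adelic)) h))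
    exact h1.countable
  -- strictness transports: `e ⁻¹' Ω` is a strict, hence a.e., fundamental domain of `N(F)`
  have hstrict : ∀ u : adelicUnipotent F E c 2, ∃! γ : rationalUnipotent F E c 2,
      γ • u ∈ (e : adelicUnipotent F E c 2 → unipotentInBorel F E c 2) ⁻¹' Ω := by
    intro u
    obtain ⟨γ, hγ, huniq⟩ := hΩu (e u)
    refine ⟨⟨e.symm (γ : unipotentInBorel F E c 2), γ.2⟩, ?_, ?_⟩
    · change e (e.symm (γ : unipotentInBorel F E c 2) * u) ∈ Ω
      rw [map_mul, ContinuousMulEquiv.apply_symm_apply]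
      exact hγ
    · intro γ' hγ'
      have h := huniq ⟨e (γ' : adelicUnipotent F E c 2), γ'.2⟩ (by
        change ((⟨e (γ' : adelicUnipotent F E c 2), γ'.2⟩ : (((quasiSplit F E c 2).arithmeticSubgroup).subgroupOf
          (borelAdelic F E c 2)).subgroupOf (unipotentInBorel F E c 2)) : unipotentInBorel F E c 2) * e u ∈ Ω
        change e ((γ' : adelicUnipotent F E c 2) * u) ∈ Ω at hγ'
        rw [map_mul] at hγ'
        exact hγ')
      apply Subtype.ext
      change (γ' : adelicUnipotent F E c 2) = e.symm (γ : unipotentInBorel F E c 2)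
      rw [← h]
      exact (e.symm_apply_apply _).symm
  have hFD : IsFundamentalDomain (rationalUnipotent F E c 2)
      ((e : adelicUnipotent F E c 2 → unipotentInBorel F E c 2) ⁻¹' Ω) ν :=
    IsFundamentalDomain.mk' hΩ'.nullMeasurableSet hstrict
  -- compare with the line box `n(𝓕⁻)` (★ H-B1)
  have hline := isFundamentalDomain_image_traceZeroFundamentalDomain_two (F := F) (E := E) (c := c) rfl rfl hc ν
  have hlt := measure_image_traceZeroFundamentalDomain_lt_top_two (F := F) (E := E) (c := c) rfl rfl hc ν
  have hne : ν ((e : adelicUnipotent F E c 2 → unipotentInBorel F E c 2) ⁻¹' Ω) ≠ 0 :=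
    hFD.measure_ne_zero (NeZero.ne ν)
  rw [← hνΩ]
  exact ⟨hne, by rw [hFD.measure_eq hline]; exact hlt⟩

/-- `μ_N(Ω) ≠ 0` for a measurable strict fundamental set `Ω` of `N(F)_N` in `N(𝔸_F) ≤ B(𝔸_F)` of `U(J₂)`.
[cite: Rogawski1990, §2.1 (p. 11)] -/
theorem measure_strictFundamentalSet_unipotent_ne_zero_two (hc : c * c = 1)
    (μN : Measure (unipotentInBorel F E c 2)) [μN.IsHaarMeasure]
    {Ω : Set (unipotentInBorel F E c 2)} (hΩ : MeasurableSet Ω)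
    (hΩu : ∀ n : unipotentInBorel F E c 2,
      ∃! ν : (((quasiSplit F E c 2).arithmeticSubgroup).subgroupOf (borelAdelic F E c 2)).subgroupOf
        (unipotentInBorel F E c 2), ν • n ∈ Ω) :
    μN Ω ≠ 0 :=
  (measure_strictFundamentalSet_unipotent_ne_zero_and_lt_top_two hc μN hΩ hΩu).1

/-- `μ_N(Ω) ≠ ∞` for a measurable strict fundamental set `Ω` of `N(F)_N` in `N(𝔸_F) ≤ B(𝔸_F)` of `U(J₂)` — the
integrability clause of ★ (C-G)_two (B) then drops `μ_N(Ω)` (Mathlib `integrable_smul_iff`). [cite: Rogawski1990, §2.1 (p. 11)] -/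
theorem measure_strictFundamentalSet_unipotent_ne_top_two (hc : c * c = 1)
    (μN : Measure (unipotentInBorel F E c 2)) [μN.IsHaarMeasure]
    {Ω : Set (unipotentInBorel F E c 2)} (hΩ : MeasurableSet Ω)
    (hΩu : ∀ n : unipotentInBorel F E c 2,
      ∃! ν : (((quasiSplit F E c 2).arithmeticSubgroup).subgroupOf (borelAdelic F E c 2)).subgroupOf
        (unipotentInBorel F E c 2), ν • n ∈ Ω) :
    μN Ω ≠ ⊤ :=
  (measure_strictFundamentalSet_unipotent_ne_zero_and_lt_top_two hc μN hΩ hΩu).2.ne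

/-- `0 < μ_N.real(Ω)` for a measurable strict fundamental set `Ω` of `N(F)_N` in `N(𝔸_F) ≤ B(𝔸_F)` of `U(J₂)` (so the
factor `μ_N.real Ω` of ★ (C-G)_two (B) is invertible). [cite: Rogawski1990, §2.1 (p. 11)] -/
theorem measureReal_strictFundamentalSet_unipotent_pos_two (hc : c * c = 1)
    (μN : Measure (unipotentInBorel F E c 2)) [μN.IsHaarMeasure]
    {Ω : Set (unipotentInBorel F E c 2)} (hΩ : MeasurableSet Ω)
    (hΩu : ∀ n : unipotentInBorel F E c 2,
      ∃! ν : (((quasiSplit F E c 2).arithmeticSubgroup).subgroupOf (borelAdelic F E c 2)).subgroupOf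
        (unipotentInBorel F E c 2), ν • n ∈ Ω) :
    0 < μN.real Ω := by
  obtain ⟨h0, ht⟩ := measure_strictFundamentalSet_unipotent_ne_zero_and_lt_top_two hc μN hΩ hΩu
  exact ENNReal.toReal_pos h0 ht.ne

/-! ## §2 Existence, packaged: the `(Ω, hΩ, hΩu)` data of ★ (C-G)_two with its mass bounds -/

/-- **A MEASURABLE STRICT FUNDAMENTAL SET OF `N(F)_N` IN `N(𝔸_F) ≤ B(𝔸_F)` OF `U(J₂)` EXISTS, OF POSITIVE FINITE HAAR
MASS** for every Haar measure `μ_N` (★ `exists_measurableSet_existsUnique_smul_mem_unipotentInBorel` + §1) — the data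
`(hΩ, hΩu)` of ★ `exists_weight_torus_kAverage_of_unipotent_invariant_two`, with «`m(N∖𝐍)`» a genuine positive real.
[cite: Rogawski1990, §2.1 (p. 11)] [cite: Rogawski1990, §7.3 (pp. 96–98)] [cite: Arthur1978TraceFormulaI, §1] -/
theorem exists_strictFundamentalSet_unipotent_two (hc : c * c = 1) :
    ∃ Ω : Set (unipotentInBorel F E c 2), MeasurableSet Ω ∧
      (∀ n : unipotentInBorel F E c 2,
        ∃! ν : (((quasiSplit F E c 2).arithmeticSubgroup).subgroupOf (borelAdelic F E c 2)).subgroupOf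
          (unipotentInBorel F E c 2), ν • n ∈ Ω) ∧
      ∀ (μN : Measure (unipotentInBorel F E c 2)), μN.IsHaarMeasure → μN Ω ≠ 0 ∧ μN Ω < ⊤ := by
  obtain ⟨Ω, hΩ, hΩu⟩ := exists_measurableSet_existsUnique_smul_mem_unipotentInBorel (F := F) (E := E) (c := c) (N := 2)
  exact ⟨Ω, hΩ, hΩu, fun μN _ => measure_strictFundamentalSet_unipotent_ne_zero_and_lt_top_two hc μN hΩ hΩu⟩

end UnitaryGroup

end Literature.NumberTheory.Automorphic

end
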